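import Summits.QuantumFields.YangMills.Theorems.BalabanUVNodesN15KingModelGradCellOscillationLevels
import HarnessLib

/-!
# N15 (NE2), King-model rung — THE CELL-OSCILLATION ROW OF THE KING GRADIENT, part 3∕3: ★★ `hasMaj_kingGrad_comp_mulOp_pull_of_lineMean_zero` and ★ dag-n15-a III-B's
# input `hDGc` PRODUCED on the King rung — `(N′∇′_ν ⊗ 1)(A₀′⁻¹ ⊗ 1) ∘ 𝔇(M_{c′}, M_{blockAvg c′}) ≤ C·r·((k+2)∕L^k)·e^{−δ|y−y′|_M}`, UNIFORM IN THE REFINEMENT `m`, no letter on `∇c′`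

WHY.  See part 1's header: the gradient entry of the first-order dressed pair (dag-n15-a III-B `hasMaj_idef_bgPair_of_sandwichRows`) needs exactly this row; the unit-block
mixed row would cost `(m+k)·log L`.  WHAT.  §7 `exp_level_mono`, `abs_cmul_mul_le`, ★★ `hasMaj_kingGrad_comp_mulOp_pull_of_lineMean_zero`: for a fine multiplier `g` with ZERO
`κ`-LINE MEANS on the cells of King's pairing and `|g| ≤ ω`, `HasMaj (coarse King blocks `blkFine`) (fine unit blocks) ((N′∇′_ν ⊗ 1)(A₀′⁻¹ ⊗ 1) ∘ (M_g ∘ P)) (C·ω·((k+2)∕L^k)·e^{−δ|y−y′|})`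
— dag-n15-a M-A's `hasMaj_comp_mulOp_pull_of_lineMean_zero` at `T′ :=` King's gradient WITHOUT its unit-block mixed-row hypothesis: the multiplier is cut (per observation
point) into NEAR cells (fine ball of radius `2L^m`: part 1 `tdistT_lt_of_not_far`; the (1,0) PROFILE n15-e R-c `fullPropD_profile_unif` summed by part 2 `nearLevels_sum_le`; a live
near term forces the unit blocks to be adjacent, part 1 `tdistT_blockOf_le_one_of_lt`, so the block decay is free) and FAR cells (M-A's exact divergence form `M_g∘P = −N′(s_κ⁻¹ −
1)∘M_{linePrim g}∘P`, `|linePrim g| ≤ L^{−k}ω`, part 1 `kingGrad_divAdj_apply_eq_sum`; the (1,1) PROFILE WITH BLOCK DECAY n15-e V-a `fullPropDD_profile_decay_unif` summed by part 2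
`farLevels_sum_le`); §8 ★ `hasMaj_kingDOp_comp_idef_mulOp_blockAvg`: III-B's `hDGc` verbatim at `G′ := A₀′⁻¹ ⊗ 1` (M-C `idef_mulOp_eq` + `cellSweep_eq_pull_blockAvg`, M-A
`lineMean_sweepPiece`∕`abs_sweepPiece_le`∕`sum_sweepPiece`, each of the `d + 1` pieces is ★★).  ONE declared `set_option maxHeartbeats 4000000 in` on ★★ and `800000` on ★
(the kernel-sum bookkeeping; the farm elaborates the file in ≈ 50 s).
HONEST FRAMING ∕ LIMITS.  Count-neutral kernel ∕ lattice bookkeeping on King's `A = 0` MODEL (template literature — C. King's scalar U(1)-Higgs model on finite tori,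
[King1986] (2.13)–(2.17) p. 653, Prop. 3.7 (3.63) p. 663, (4.42)–(4.44) p. 675), NOT Bałaban's covariant `G(U)`; [Balaban1985BackgroundPropagators] (3.35) p. 396, (3.52) p. 400,
(3.62)–(3.65) p. 402 are cited as the MECHANISM of the first-order dressed pair only.  NE2⁺ is NOT PRINTED and NOT proved here; N15 is NOT discharged; K3⁸
OPEN 0∕2; counts of record UNMOVED (typed 28∕28 · discharged 5∕27 · A 5∕28); one finite torus at fixed spacings per index — NOT ℝ⁴ ∕ infinite volume ∕ OS ∕ mass gap ∕ Clay.
0 `sorry`, 0 `def`, standard axioms.  Cell `pub-ymgap`, seat `pub-ymgap-dag-n15-d` (R134 N15 NE2 s3, King-model rung), generation 20; `--kind proof --supports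
stmt-QuantumFields-27366 --as helper` (K3⁸).  Consumer: dag-n15-a programme M-III, III-B `hasMaj_idef_bgPair_of_sandwichRows` hypothesis `hDGc` («ROW (go)» INBOX l.≈42090).
-/

noncomputable section

open scoped BigOperators
open Finset

namespace Summit.QuantumFields.YangMills.BalabanUVNodes.N15.KingModel.CellOsc

open Literature.MathematicalPhysics.QuantumFieldTheory.Balaban1983to89
open Literature.MathematicalPhysics.QuantumFieldTheory.Balaban1983to89.B11SectG (BlockNorm HasMaj hasMaj_sum)
open Literature.MathematicalPhysics.QuantumFieldTheory.Balaban1983to89.B11AxialTransport190 (abs_le_loc_ofBlocks loc_ofBlocks_le)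
open Literature.MathematicalPhysics.QuantumFieldTheory.Balaban1983to89.T4EtaRateDefect (idef idef_apply)
open Literature.MathematicalPhysics.QuantumFieldTheory.Balaban1983to89.T4EtaRateCoeffDefect (pull pull_apply blockAvg idef_mulOp_eq)
open Literature.MathematicalPhysics.QuantumFieldTheory.Balaban1983to89.B6Prop26Gluing (mulOp mulOp_apply)
open Literature.MathematicalPhysics.QuantumFieldTheory.Balaban1983to89.B5Prop11Plancherel (Tor fine unitVec)
open Literature.MathematicalPhysics.QuantumFieldTheory.Balaban1983to89.B4TorusKernel.MultiPeriod (circAbs circAbs_le_abs)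
open Literature.MathematicalPhysics.QuantumFieldTheory.Balaban1983to89.B4Sect5Torus (tdist)
open Literature.MathematicalPhysics.QuantumFieldTheory.Balaban1983to89.B6BondEliminationTorus (tdist_le_of_forall)
open Literature.MathematicalPhysics.QuantumFieldTheory.Balaban1983to89.B6UnitTorusCarrier (unitTorusGeo)
open Literature.MathematicalPhysics.QuantumFieldTheory.King1986 (aK aK_pos)
open Literature.MathematicalPhysics.QuantumFieldTheory.King1986.Torus (fineOp constrainedProp blockOf tdistT tdistT_nonneg tdistT_symm tdistT_self
  tdistT_triangle toSite one_le_period)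
open Summit.QuantumFields.YangMills.BalabanUVNodes.N15.VectorPiece (kingPr kingPrV kingPr_val kingPrV_eq blkFine blkFine_comp_kingPrV tensorId tensorId_apply)
open Summit.QuantumFields.YangMills.BalabanUVNodes.N15.TwoGrid
open Summit.QuantumFields.YangMills.BalabanUVNodes.N15KingModelRung.Curved

variable {d : ℕ} (L : ℕ) [NeZero L] (M : Fin (d + 1) → ℕ) [∀ μ, NeZero (M μ)] (k m : ℕ)

/-! ## §7 ★★ The cell-oscillation row of the King gradient behind a line-mean-zero multiplier, uniform in `m` -/

/-- monotonicity of the level exponentials in the rate. [folklore] -/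
theorem exp_level_mono {δ δ₁ t : ℝ} (h : δ₁ ≤ δ) (ht : 0 ≤ t) : Real.exp (-(δ * t)) ≤ Real.exp (-(δ₁ * t)) :=
  Real.exp_le_exp.mpr (by nlinarith)

/-- three-factor products under absolute values. [folklore] -/
theorem abs_cmul_mul_le {c t x T X : ℝ} (hc : 0 ≤ c) (ht : |t| ≤ T) (hx : |x| ≤ X) : |c * t * x| ≤ c * T * X := by
  rw [abs_mul, abs_mul, abs_of_nonneg hc]
  have hT : 0 ≤ T := (abs_nonneg t).trans ht
  exact mul_le_mul (mul_le_mul_of_nonneg_left ht hc) hx (abs_nonneg _) (mul_nonneg hc hT)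

set_option maxHeartbeats 4000000 in
/-- ★★ **THE CELL-OSCILLATION ROW OF THE GRADIENT OF KING's FULL `A = 0` PROPAGATOR BEHIND A `κ`-LINE-MEAN-ZERO MULTIPLIER, UNIFORM IN THE REFINEMENT.**
For odd `L ≥ 3` (stated `Odd L`, `2 ≤ L`), `d ≥ 1`, `a > 0`, `m₀² ≥ 0` there are `C, δ > 0` (functions of `d, L, a, m₀²`) such that for EVERY coarse level `k ≥ 1`, refinement `m`,
cube `M_μ = 2L^e`, mass `0 < m² ≤ m₀²`, directions `ν, κ`, and every fine multiplier `g` with ZERO `κ`-LINE MEANS on the cells of King's pairing and `|g| ≤ ω`: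
`HasMaj (coarse King blocks) (fine unit blocks) ((N′∇′_ν ⊗ 1)(A₀′⁻¹ ⊗ 1) ∘ (M_g ∘ P)) (C·ω·((k+2)∕L^k)·e^{−δ|y−y′|_M})` — dag-n15-a M-A's
`hasMaj_comp_mulOp_pull_of_lineMean_zero` at `T′ :=` King's gradient WITHOUT its unit-block mixed-row hypothesis (whose constant `log N′ = (m+k)log L` is
m-nonuniform): NEAR cells (fine ball of radius `2L^m` around the observation point) by the (1,0) PROFILE of n15-e `fullPropD_profile_unif` summed over the ball (§4);
FAR cells by M-A's exact divergence form `M_g∘P = −N′(s_κ⁻¹ − 1)∘M_{linePrim g}∘P` (`|linePrim g| ≤ L^{−k}ω`) and the (1,1) PROFILE WITH BLOCK DECAY of n15-e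
`fullPropDD_profile_decay_unif` summed outside the ball (§5) — the excluded ball kills the fine levels, the coarse ones count `k + 1`.
[cite: King1986, (2.13)–(2.17) p.653, Prop. 3.7 (3.63) p.663, (4.42)–(4.44) p.675; Balaban1985BackgroundPropagators, (3.35) p.396, (3.52) p.400, (3.62)–(3.65) p.402 (the first-order dressed pair: mechanism); Balaban1983RegularityDecay, Theorem (1.10) p.573] -/
theorem hasMaj_kingGrad_comp_mulOp_pull_of_lineMean_zero (hd : 1 ≤ d) (hLodd : Odd L) (hL : 2 ≤ L) {a : ℝ} (ha : 0 < a) {m0sq : ℝ} (hm0 : 0 ≤ m0sq) :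
    ∃ C δ : ℝ, 0 < C ∧ 0 < δ ∧ ∀ (k : ℕ), 1 ≤ k → ∀ (m e : ℕ) (M : Fin (d + 1) → ℕ) [∀ μ, NeZero (M μ)], (∀ μ, M μ = 2 * L ^ e) →
      ∀ (msq : ℝ), 0 < msq → msq ≤ m0sq → ∀ (ν κ : Fin (d + 1)) (g : Tor (fine (L ^ m * L ^ k) M) × Fin (d + 1) → ℝ) (ω : ℝ), 0 ≤ ω →
      lineMean M (L ^ m * L ^ k) (L ^ m) κ g = 0 → (∀ z, |g z| ≤ ω) →
      HasMaj (BlockNorm.ofBlocks (unitTorusGeo L k M) (blkFine L k M))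
        (BlockNorm.ofBlocks (unitTorusGeo L k M) (fun i : Tor (fine (L ^ m * L ^ k) M) × Fin (d + 1) => blockOf (L ^ m * L ^ k) M i.1))
        ((symbOp M (L ^ m * L ^ k) (sD M (L ^ m * L ^ k) ν ((L ^ m * L ^ k : ℕ) : ℝ)) ∘ₗ tensorId (Fin (d + 1)) (kingGOp L a msq (k + m) (L ^ m * L ^ k) M))
          ∘ₗ (mulOp g ∘ₗ pull (kingPrV L k m M)))
        (fun y y' => C * ω * ((((k : ℕ) : ℝ) + 2) / (L : ℝ) ^ k) * Real.exp (-(δ * tdistT M y y'))) := by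
  classical
  have hL1 : (1 : ℝ) < L := by exact_mod_cast (show 1 < L by omega)
  have hL0 : (0 : ℝ) < L := by linarith
  obtain ⟨C₁, δa, hC₁, hδa, HD⟩ := fullPropD_profile_unif (d := d) L hLodd hL ha hm0
  obtain ⟨C₂, δb, hC₂, hδb, HDD⟩ := fullPropDD_profile_decay_unif (d := d) L hLodd hL ha hm0
  -- the common level rate `δ₁ ≤ δa, δb, 1`
  set δ₁ : ℝ := min (min δa δb) 1 with hδ₁def
  have hδ₁0 : 0 < δ₁ := lt_min (lt_min hδa hδb) one_pos
  have hδ₁a : δ₁ ≤ δa := (min_le_left _ _).trans (min_le_left _ _)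
  have hδ₁b : δ₁ ≤ δb := (min_le_left _ _).trans (min_le_right _ _)
  have hδ₁1 : δ₁ ≤ 1 := min_le_right _ _
  set An : ℝ := 2 * (5 : ℝ) ^ (d + 1) + 2 * (8 * ((d : ℝ) + 1) / δ₁) ^ (d + 1) with hAn
  set Af : ℝ := 2 * (2 * (8 * ((d : ℝ) + 1)) / δ₁) ^ (d + 1) * (1 + (1 - Real.exp (-(δ₁ / 2)))⁻¹) with hAf
  have hr0 : 0 < 1 - Real.exp (-(δ₁ / 2)) := by
    have : Real.exp (-(δ₁ / 2)) < 1 := Real.exp_lt_one_iff.mpr (by linarith)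
    linarith
  have hAn0 : 0 < An := by positivity
  have hAf0 : 0 < Af := by positivity
  refine ⟨C₁ * An * Real.exp δb + C₂ * Af, δb, by positivity, hδb, ?_⟩
  intro k hk m e M _ hM msq hmsq hcap ν κ g ω hω hg0 hg
  have hn'pow : L ^ m * L ^ k = L ^ (k + m) := nfine_eq_pow L k m
  have hn'R : (0 : ℝ) < ((L ^ m * L ^ k : ℕ) : ℝ) := by rw [hn'pow]; positivity
  have hℓ0 : 0 < L ^ m := pow_pos (Nat.pos_of_ne_zero (NeZero.ne L)) m
  have hLk0 : (0 : ℝ) < (L : ℝ) ^ k := pow_pos hL0 k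
  -- `2L^m ≤ n′` (needs `k ≥ 1`, `L ≥ 2`)
  have h2Lm : 2 * ((L ^ m : ℕ) : ℝ) ≤ ((L ^ m * L ^ k : ℕ) : ℝ) := by
    have h2k : (2 : ℝ) ≤ (L : ℝ) ^ k := by
      calc (2 : ℝ) ≤ (L : ℝ) ^ 1 := by rw [pow_one]; exact_mod_cast hL
        _ ≤ (L : ℝ) ^ k := pow_le_pow_right₀ hL1.le hk
    push_cast
    nlinarith [pow_pos hL0 m]
  have hcell : ((L ^ m : ℕ) : ℝ) / ((L ^ m * L ^ k : ℕ) : ℝ) = ((L : ℝ) ^ k)⁻¹ := by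
    have hLm0 : (L : ℝ) ^ m ≠ 0 := pow_ne_zero _ hL0.ne'
    have hLk0' : (L : ℝ) ^ k ≠ 0 := pow_ne_zero _ hL0.ne'
    push_cast
    field_simp
  intro y' φ hφ y
  -- the source size
  set F : ℝ := (BlockNorm.ofBlocks (unitTorusGeo L k M) (blkFine L k M)).loc y' φ with hF
  have hF0 : 0 ≤ F := (BlockNorm.ofBlocks (unitTorusGeo L k M) (blkFine L k M)).loc_nonneg y' φ
  have hφF : ∀ q, |φ q| ≤ F := fun q => by
    by_cases hq : blkFine L k M q = y'
    · exact abs_le_loc_ofBlocks (g := unitTorusGeo L k M) (blkFine L k M) φ hq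
    · rw [hφ q hq, abs_zero]; exact hF0
  have hφ0 : ∀ q, blkFine L k M q ≠ y' → φ q = 0 := fun q hq => hφ q hq
  refine loc_ofBlocks_le (g := unitTorusGeo L k M) _ _ (by positivity) fun p hp => ?_
  set D : ℝ := tdistT M y y' with hD
  -- the near∕far split of the multiplier around the observation point `p.1`
  -- the FAR predicate (cell-constant), as an opaque predicate
  obtain ⟨S, hSdef⟩ : ∃ S : Tor (fine (L ^ m * L ^ k) M) → Prop,
      S = fun z => ∀ s' : Tor (fine (L ^ m * L ^ k) M), kingPr L k m M s' = kingPr L k m M z → ((L ^ m : ℕ) : ℝ) ≤ tdistT (fine (L ^ m * L ^ k) M) p.1 s' := ⟨_, rfl⟩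
  have hSiff : ∀ z, S z ↔ ∀ s' : Tor (fine (L ^ m * L ^ k) M), kingPr L k m M s' = kingPr L k m M z → ((L ^ m : ℕ) : ℝ) ≤ tdistT (fine (L ^ m * L ^ k) M) p.1 s' :=
    fun z => by rw [hSdef]
  have hS : ∀ s z, kingPr L k m M s = kingPr L k m M z → (S s ↔ S z) := fun s z h => by
    rw [hSiff, hSiff]; exact far_cellConst L M k m p.1 s z h
  haveI : DecidablePred S := Classical.decPred S
  obtain ⟨gF, hgF⟩ : ∃ f : Tor (fine (L ^ m * L ^ k) M) × Fin (d + 1) → ℝ, ∀ z, f z = if S z.1 then g z else 0 := ⟨_, fun _ => rfl⟩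
  obtain ⟨gN, hgN⟩ : ∃ f : Tor (fine (L ^ m * L ^ k) M) × Fin (d + 1) → ℝ, ∀ z, f z = if S z.1 then 0 else g z := ⟨_, fun _ => rfl⟩
  have hgF_le : ∀ z, |gF z| ≤ ω := fun z => abs_cellCut_le L M k m hgF hω hg z
  have hgN_le : ∀ z, |gN z| ≤ ω := fun z => by
    rw [hgN]
    by_cases h : S z.1
    · rw [if_pos h, abs_zero]; exact hω
    · rw [if_neg h]; exact hg z
  have hsplit : mulOp g ∘ₗ pull (kingPrV L k m M) = mulOp gN ∘ₗ pull (kingPrV L k m M) + mulOp gF ∘ₗ pull (kingPrV L k m M) := by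
    refine LinearMap.ext fun ψ => funext fun z => ?_
    simp only [LinearMap.add_apply, Pi.add_apply, LinearMap.comp_apply, mulOp_apply]
    rw [hgN, hgF]
    by_cases h : S z.1
    · rw [if_pos h, if_pos h]; ring
    · rw [if_neg h, if_neg h]; ring
  rw [hsplit, LinearMap.comp_add, LinearMap.add_apply, Pi.add_apply]
  -- ===== the NEAR part =====
  have hnear : abs ((((symbOp M (L ^ m * L ^ k) (sD M (L ^ m * L ^ k) ν ((L ^ m * L ^ k : ℕ) : ℝ)) ∘ₗ tensorId (Fin (d + 1)) (kingGOp L a msq (k + m) (L ^ m * L ^ k) M))) ∘ₗ (mulOp gN ∘ₗ pull (kingPrV L k m M))) φ p)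
      ≤ C₁ * An * Real.exp δb * ω * (((L : ℝ) ^ k)⁻¹) * Real.exp (-(δb * D)) * F := by
    rw [LinearMap.comp_apply, kingGrad_apply_eq_sum]
    -- a live term sits in a NEAR cell whose unit block is `y′`
    have hlive : ∀ z : Tor (fine (L ^ m * L ^ k) M), gN (z, p.2) * φ (kingPrV L k m M (z, p.2)) ≠ 0 →
        tdistT (fine (L ^ m * L ^ k) M) p.1 z < 2 * ((L ^ m : ℕ) : ℝ) ∧ blockOf (L ^ m * L ^ k) M z = y' := by
      intro z hz0
      have hgNz : gN (z, p.2) ≠ 0 := fun h => hz0 (by rw [h, zero_mul])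
      have hφz : φ (kingPrV L k m M (z, p.2)) ≠ 0 := fun h => hz0 (by rw [h, mul_zero])
      have hnotS : ¬ S z := by
        intro h; apply hgNz; rw [hgN, if_pos h]
      refine ⟨tdistT_lt_of_not_far L M k m (fun h => hnotS ((hSiff z).mpr h)), ?_⟩
      have h1 : blkFine L k M (kingPrV L k m M (z, p.2)) = y' := by
        by_contra hne; exact hφz (hφ0 _ hne)
      have h2 := congrFun (blkFine_comp_kingPrV M L k m) (z, p.2)
      simp only [Function.comp_apply] at h2
      rw [← h2]; exact h1
    -- the sum lives on the near ball
    rw [← Finset.sum_filter_of_ne (p := fun z => tdistT (fine (L ^ m * L ^ k) M) p.1 z < 2 * ((L ^ m : ℕ) : ℝ)) (fun z _ hz => by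
      refine (hlive z fun h0 => hz ?_).1
      rw [LinearMap.comp_apply, mulOp_apply, pull_apply, mul_assoc, h0, mul_zero, mul_zero])]
    -- termwise bound on the near ball
    have hterm : ∀ z ∈ univ.filter (fun z => tdistT (fine (L ^ m * L ^ k) M) p.1 z < 2 * ((L ^ m : ℕ) : ℝ)),
        |((((L ^ m * L ^ k : ℕ) : ℝ)) ^ (d + 1))⁻¹ * (((L ^ m * L ^ k : ℕ) : ℝ) * (constrainedProp (L ^ m * L ^ k) M (aK a L (k + m)) (((L ^ m * L ^ k : ℕ) : ℝ) ^ 2) msq (p.1 + unitVec (fine (L ^ m * L ^ k) M) ν) z - constrainedProp (L ^ m * L ^ k) M (aK a L (k + m)) (((L ^ m * L ^ k : ℕ) : ℝ) ^ 2) msq p.1 z)) * (mulOp gN ∘ₗ pull (kingPrV L k m M)) φ (z, p.2)|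
          ≤ ((((L ^ m * L ^ k : ℕ) : ℝ)) ^ (d + 1))⁻¹ * (C₁ * (∑ i ∈ range (k + m), ((L : ℝ) ^ (d + 1) / (L : ℝ) ^ 2 * L) ^ i * Real.exp (-(δ₁ * (tdistT (fine (L ^ m * L ^ k) M) p.1 z * (L : ℝ) ^ i / ((L ^ m * L ^ k : ℕ) : ℝ)))))) * (ω * (Real.exp δb * Real.exp (-(δb * D)) * F)) := by
      intro z _
      rw [LinearMap.comp_apply, mulOp_apply, pull_apply]
      have hsum0 : 0 ≤ (∑ i ∈ range (k + m), ((L : ℝ) ^ (d + 1) / (L : ℝ) ^ 2 * L) ^ i * Real.exp (-(δ₁ * (tdistT (fine (L ^ m * L ^ k) M) p.1 z * (L : ℝ) ^ i / ((L ^ m * L ^ k : ℕ) : ℝ))))) := Finset.sum_nonneg fun i _ => by positivity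
      by_cases hz0 : gN (z, p.2) * φ (kingPrV L k m M (z, p.2)) = 0
      · rw [mul_assoc, hz0, mul_zero, mul_zero, abs_zero]; positivity
      obtain ⟨hlt, hblk⟩ := hlive z hz0
      have hD1 : D ≤ 1 := by
        have hn : tdistT (fine (L ^ m * L ^ k) M) p.1 z < ((L ^ m * L ^ k : ℕ) : ℕ) := by
          have : (2 : ℝ) * ((L ^ m : ℕ) : ℝ) ≤ ((L ^ m * L ^ k : ℕ) : ℕ) := by exact_mod_cast h2Lm
          linarith
        have h := tdistT_blockOf_le_one_of_lt M (L ^ m * L ^ k) hn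
        rw [hp, hblk] at h; exact h
      have hdec : 1 ≤ Real.exp δb * Real.exp (-(δb * D)) := by
        rw [← Real.exp_add]; exact Real.one_le_exp (by nlinarith)
      have hDk := HD (k + m) (by omega) (L ^ m * L ^ k) hn'pow e M hM msq hmsq hcap ν p.1 z
      have hprof : (∑ i ∈ range (k + m), ((L : ℝ) ^ (d + 1) / (L : ℝ) ^ 2 * L) ^ i
            * Real.exp (-(δa * (tdistT (fine (L ^ m * L ^ k) M) p.1 z * (L : ℝ) ^ i / ((L ^ m * L ^ k : ℕ) : ℝ))))) ≤ (∑ i ∈ range (k + m), ((L : ℝ) ^ (d + 1) / (L : ℝ) ^ 2 * L) ^ i * Real.exp (-(δ₁ * (tdistT (fine (L ^ m * L ^ k) M) p.1 z * (L : ℝ) ^ i / ((L ^ m * L ^ k : ℕ) : ℝ))))) :=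
        Finset.sum_le_sum fun i _ => mul_le_mul_of_nonneg_left
          (exp_level_mono hδ₁a (by have := tdistT_nonneg (fine (L ^ m * L ^ k) M) p.1 z; positivity)) (by positivity)
      have h1 : |gN (z, p.2) * φ (kingPrV L k m M (z, p.2))| ≤ ω * (Real.exp δb * Real.exp (-(δb * D)) * F) := by
        rw [abs_mul]
        calc |gN (z, p.2)| * |φ (kingPrV L k m M (z, p.2))| ≤ ω * F := mul_le_mul (hgN_le _) (hφF _) (abs_nonneg _) hω
          _ = ω * (1 * F) := by ring
          _ ≤ ω * (Real.exp δb * Real.exp (-(δb * D)) * F) :=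
              mul_le_mul_of_nonneg_left (mul_le_mul_of_nonneg_right hdec hF0) hω
      have hT : |(((L ^ m * L ^ k : ℕ) : ℝ) * (constrainedProp (L ^ m * L ^ k) M (aK a L (k + m)) (((L ^ m * L ^ k : ℕ) : ℝ) ^ 2) msq (p.1 + unitVec (fine (L ^ m * L ^ k) M) ν) z - constrainedProp (L ^ m * L ^ k) M (aK a L (k + m)) (((L ^ m * L ^ k : ℕ) : ℝ) ^ 2) msq p.1 z))| ≤ C₁ * (∑ i ∈ range (k + m), ((L : ℝ) ^ (d + 1) / (L : ℝ) ^ 2 * L) ^ i * Real.exp (-(δ₁ * (tdistT (fine (L ^ m * L ^ k) M) p.1 z * (L : ℝ) ^ i / ((L ^ m * L ^ k : ℕ) : ℝ))))) := hDk.trans (mul_le_mul_of_nonneg_left hprof hC₁.le)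
      exact abs_cmul_mul_le (by positivity) hT h1
    refine (abs_sum_le_sum_abs _ _).trans ((Finset.sum_le_sum hterm).trans ?_)
    rw [← Finset.sum_mul, ← Finset.mul_sum, ← Finset.mul_sum]
    have hnearS := nearLevels_sum_le L M k m hd hL hδ₁0 hδ₁1 p.1
    have hc : ((((L ^ m * L ^ k : ℕ) : ℝ)) ^ (d + 1))⁻¹ * (C₁ * (An * ((L ^ m * L ^ k : ℕ) : ℝ) ^ (d + 1) * ((L : ℝ) ^ k)⁻¹)) = C₁ * An * ((L : ℝ) ^ k)⁻¹ := by
      field_simp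
    calc ((((L ^ m * L ^ k : ℕ) : ℝ)) ^ (d + 1))⁻¹ * (C₁ * ∑ z ∈ univ.filter (fun z => tdistT (fine (L ^ m * L ^ k) M) p.1 z < 2 * ((L ^ m : ℕ) : ℝ)), (∑ i ∈ range (k + m), ((L : ℝ) ^ (d + 1) / (L : ℝ) ^ 2 * L) ^ i * Real.exp (-(δ₁ * (tdistT (fine (L ^ m * L ^ k) M) p.1 z * (L : ℝ) ^ i / ((L ^ m * L ^ k : ℕ) : ℝ))))))
          * (ω * (Real.exp δb * Real.exp (-(δb * D)) * F))
        ≤ ((((L ^ m * L ^ k : ℕ) : ℝ)) ^ (d + 1))⁻¹ * (C₁ * (An * ((L ^ m * L ^ k : ℕ) : ℝ) ^ (d + 1) * ((L : ℝ) ^ k)⁻¹)) * (ω * (Real.exp δb * Real.exp (-(δb * D)) * F)) :=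
          mul_le_mul_of_nonneg_right (mul_le_mul_of_nonneg_left (mul_le_mul_of_nonneg_left hnearS hC₁.le) (by positivity)) (by positivity)
      _ = C₁ * An * Real.exp δb * ω * ((L : ℝ) ^ k)⁻¹ * Real.exp (-(δb * D)) * F := by rw [hc]; ring
  -- ===== the FAR part =====
  have hfar : abs ((((symbOp M (L ^ m * L ^ k) (sD M (L ^ m * L ^ k) ν ((L ^ m * L ^ k : ℕ) : ℝ)) ∘ₗ tensorId (Fin (d + 1)) (kingGOp L a msq (k + m) (L ^ m * L ^ k) M))) ∘ₗ (mulOp gF ∘ₗ pull (kingPrV L k m M))) φ p)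
      ≤ C₂ * Af * ω * ((((k : ℕ) : ℝ) + 2) * ((L : ℝ) ^ k)⁻¹) * Real.exp (-(δb * D)) * F := by
    have hgF0 : lineMean M (L ^ m * L ^ k) (L ^ m) κ gF = 0 := lineMean_cellCut_eq_zero L M k m hS hgF hg0
    rw [mulOp_comp_pull_eq_neg_divAdj_of_lineMean M L k m κ hgF0, LinearMap.comp_neg, LinearMap.neg_apply, Pi.neg_apply, abs_neg,
      ← LinearMap.comp_assoc, LinearMap.comp_apply, kingGrad_divAdj_apply_eq_sum]
    obtain ⟨h, hh⟩ : ∃ h' : Tor (fine (L ^ m * L ^ k) M) × Fin (d + 1) → ℝ, linePrim M (L ^ m * L ^ k) (L ^ m) κ gF = h' := ⟨_, rfl⟩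
    rw [hh]
    have hh_le : ∀ z, |h z| ≤ ((L ^ m : ℕ) : ℝ) / ((L ^ m * L ^ k : ℕ) : ℝ) * ω := fun z => by
      rw [← hh]; exact abs_linePrim_le M (L ^ m * L ^ k) hℓ0 κ hω fun j _ => hgF_le _
    have hh0 : ∀ z : Tor (fine (L ^ m * L ^ k) M) × Fin (d + 1), ¬ S z.1 → h z = 0 := fun z hz => by
      rw [← hh]; exact linePrim_cellCut_eq_zero L M k m hS hgF hz
    -- a live term sits in a FAR cell whose unit block is `y′`
    have hlive : ∀ z : Tor (fine (L ^ m * L ^ k) M), h (z, p.2) * φ (kingPrV L k m M (z, p.2)) ≠ 0 →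
        ((L ^ m : ℕ) : ℝ) ≤ tdistT (fine (L ^ m * L ^ k) M) p.1 z ∧ blockOf (L ^ m * L ^ k) M z = y' := by
      intro z hz0
      have hhz : h (z, p.2) ≠ 0 := fun h0 => hz0 (by rw [h0, zero_mul])
      have hφz : φ (kingPrV L k m M (z, p.2)) ≠ 0 := fun h0 => hz0 (by rw [h0, mul_zero])
      have hSz : S z := by by_contra hc; exact hhz (hh0 (z, p.2) hc)
      refine ⟨(hSiff z).mp hSz z rfl, ?_⟩
      have h1 : blkFine L k M (kingPrV L k m M (z, p.2)) = y' := by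
        by_contra hne; exact hφz (hφ0 _ hne)
      have h2 := congrFun (blkFine_comp_kingPrV M L k m) (z, p.2)
      simp only [Function.comp_apply] at h2
      rw [← h2]; exact h1
    rw [← Finset.sum_filter_of_ne (p := fun z => ((L ^ m : ℕ) : ℝ) ≤ tdistT (fine (L ^ m * L ^ k) M) p.1 z) (fun z _ hz => by
      refine (hlive z fun h0 => hz ?_).1
      rw [LinearMap.comp_apply, mulOp_apply, pull_apply, mul_assoc, h0, mul_zero, mul_zero])]
    have hterm : ∀ z ∈ univ.filter (fun z => ((L ^ m : ℕ) : ℝ) ≤ tdistT (fine (L ^ m * L ^ k) M) p.1 z),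
        |((((L ^ m * L ^ k : ℕ) : ℝ)) ^ (d + 1))⁻¹ * (((L ^ m * L ^ k : ℕ) : ℝ) * (((L ^ m * L ^ k : ℕ) : ℝ) * (constrainedProp (L ^ m * L ^ k) M (aK a L (k + m)) (((L ^ m * L ^ k : ℕ) : ℝ) ^ 2) msq (p.1 + unitVec (fine (L ^ m * L ^ k) M) ν) (z + unitVec (fine (L ^ m * L ^ k) M) κ) - constrainedProp (L ^ m * L ^ k) M (aK a L (k + m)) (((L ^ m * L ^ k : ℕ) : ℝ) ^ 2) msq p.1 (z + unitVec (fine (L ^ m * L ^ k) M) κ)) - ((L ^ m * L ^ k : ℕ) : ℝ) * (constrainedProp (L ^ m * L ^ k) M (aK a L (k + m)) (((L ^ m * L ^ k : ℕ) : ℝ) ^ 2) msq (p.1 + unitVec (fine (L ^ m * L ^ k) M) ν) z - constrainedProp (L ^ m * L ^ k) M (aK a L (k + m)) (((L ^ m * L ^ k : ℕ) : ℝ) ^ 2) msq p.1 z))) * (mulOp h ∘ₗ pull (kingPrV L k m M)) φ (z, p.2)|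
          ≤ ((((L ^ m * L ^ k : ℕ) : ℝ)) ^ (d + 1))⁻¹ * (C₂ * (∑ i ∈ range (k + m), ((L : ℝ) ^ (d + 1) / (L : ℝ) ^ 2 * L * L) ^ i * Real.exp (-(δ₁ * (tdistT (fine (L ^ m * L ^ k) M) p.1 z * (L : ℝ) ^ i / ((L ^ m * L ^ k : ℕ) : ℝ)))))) * (Real.exp (-(δb * D)) * (((L ^ m : ℕ) : ℝ) / ((L ^ m * L ^ k : ℕ) : ℝ) * ω * F)) := by
      intro z _
      rw [LinearMap.comp_apply, mulOp_apply, pull_apply]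
      have hsum0 : 0 ≤ (∑ i ∈ range (k + m), ((L : ℝ) ^ (d + 1) / (L : ℝ) ^ 2 * L * L) ^ i * Real.exp (-(δ₁ * (tdistT (fine (L ^ m * L ^ k) M) p.1 z * (L : ℝ) ^ i / ((L ^ m * L ^ k : ℕ) : ℝ))))) := Finset.sum_nonneg fun i _ => by positivity
      by_cases hz0 : h (z, p.2) * φ (kingPrV L k m M (z, p.2)) = 0
      · rw [mul_assoc, hz0, mul_zero, mul_zero, abs_zero]; positivity
      obtain ⟨hfarz, hblk⟩ := hlive z hz0
      have hDDk := HDD (k + m) (by omega) (L ^ m * L ^ k) hn'pow e M hM msq hmsq hcap ν κ p.1 z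
      rw [hp, hblk, ← hD, mul_assoc] at hDDk
      have hprof : (∑ i ∈ range (k + m), ((L : ℝ) ^ (d + 1) / (L : ℝ) ^ 2 * L * L) ^ i
            * Real.exp (-(δb * (tdistT (fine (L ^ m * L ^ k) M) p.1 z * (L : ℝ) ^ i / ((L ^ m * L ^ k : ℕ) : ℝ))))) ≤ (∑ i ∈ range (k + m), ((L : ℝ) ^ (d + 1) / (L : ℝ) ^ 2 * L * L) ^ i * Real.exp (-(δ₁ * (tdistT (fine (L ^ m * L ^ k) M) p.1 z * (L : ℝ) ^ i / ((L ^ m * L ^ k : ℕ) : ℝ))))) :=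
        Finset.sum_le_sum fun i _ => mul_le_mul_of_nonneg_left
          (exp_level_mono hδ₁b (by have := tdistT_nonneg (fine (L ^ m * L ^ k) M) p.1 z; positivity)) (by positivity)
      have h1 : |h (z, p.2) * φ (kingPrV L k m M (z, p.2))| ≤ ((L ^ m : ℕ) : ℝ) / ((L ^ m * L ^ k : ℕ) : ℝ) * ω * F := by
        rw [abs_mul]
        exact mul_le_mul (hh_le _) (hφF _) (abs_nonneg _) (by positivity)
      have hT : |(((L ^ m * L ^ k : ℕ) : ℝ) * (((L ^ m * L ^ k : ℕ) : ℝ) * (constrainedProp (L ^ m * L ^ k) M (aK a L (k + m)) (((L ^ m * L ^ k : ℕ) : ℝ) ^ 2) msq (p.1 + unitVec (fine (L ^ m * L ^ k) M) ν) (z + unitVec (fine (L ^ m * L ^ k) M) κ) - constrainedProp (L ^ m * L ^ k) M (aK a L (k + m)) (((L ^ m * L ^ k : ℕ) : ℝ) ^ 2) msq p.1 (z + unitVec (fine (L ^ m * L ^ k) M) κ)) - ((L ^ m * L ^ k : ℕ) : ℝ) * (constrainedProp (L ^ m * L ^ k) M (aK a L (k + m)) (((L ^ m * L ^ k : ℕ)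 : ℝ) ^ 2) msq (p.1 + unitVec (fine (L ^ m * L ^ k) M) ν) z - constrainedProp (L ^ m * L ^ k) M (aK a L (k + m)) (((L ^ m * L ^ k : ℕ) : ℝ) ^ 2) msq p.1 z)))| ≤ C₂ * ((∑ i ∈ range (k + m), ((L : ℝ) ^ (d + 1) / (L : ℝ) ^ 2 * L * L) ^ i * Real.exp (-(δ₁ * (tdistT (fine (L ^ m * L ^ k) M) p.1 z * (L : ℝ) ^ i / ((L ^ m * L ^ k : ℕ) : ℝ))))) * Real.exp (-(δb * D))) :=
        hDDk.trans (mul_le_mul_of_nonneg_left (mul_le_mul_of_nonneg_right hprof (Real.exp_pos _).le) hC₂.le)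
      exact (abs_cmul_mul_le (by positivity) hT h1).trans (le_of_eq (by ring))
    refine (abs_sum_le_sum_abs _ _).trans ((Finset.sum_le_sum hterm).trans ?_)
    rw [← Finset.sum_mul, ← Finset.mul_sum, ← Finset.mul_sum]
    have hfarS := farLevels_sum_le L M k m hL hδ₁0 hδ₁1 p.1
    have hc : ((((L ^ m * L ^ k : ℕ) : ℝ)) ^ (d + 1))⁻¹ * (C₂ * (Af * (((k : ℕ) : ℝ) + 2) * ((L ^ m * L ^ k : ℕ) : ℝ) ^ (d + 1))) * (((L ^ m : ℕ) : ℝ) / ((L ^ m * L ^ k : ℕ) : ℝ))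
        = C₂ * Af * ((((k : ℕ) : ℝ) + 2) * ((L : ℝ) ^ k)⁻¹) := by
      rw [hcell]; field_simp
    calc ((((L ^ m * L ^ k : ℕ) : ℝ)) ^ (d + 1))⁻¹ * (C₂ * ∑ z ∈ univ.filter (fun z => ((L ^ m : ℕ) : ℝ) ≤ tdistT (fine (L ^ m * L ^ k) M) p.1 z), (∑ i ∈ range (k + m), ((L : ℝ) ^ (d + 1) / (L : ℝ) ^ 2 * L * L) ^ i * Real.exp (-(δ₁ * (tdistT (fine (L ^ m * L ^ k) M) p.1 z * (L : ℝ) ^ i / ((L ^ m * L ^ k : ℕ) : ℝ))))))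
          * (Real.exp (-(δb * D)) * (((L ^ m : ℕ) : ℝ) / ((L ^ m * L ^ k : ℕ) : ℝ) * ω * F))
        ≤ ((((L ^ m * L ^ k : ℕ) : ℝ)) ^ (d + 1))⁻¹ * (C₂ * (Af * (((k : ℕ) : ℝ) + 2) * ((L ^ m * L ^ k : ℕ) : ℝ) ^ (d + 1))) * (Real.exp (-(δb * D)) * (((L ^ m : ℕ) : ℝ) / ((L ^ m * L ^ k : ℕ) : ℝ) * ω * F)) :=
          mul_le_mul_of_nonneg_right (mul_le_mul_of_nonneg_left (mul_le_mul_of_nonneg_left hfarS hC₂.le) (by positivity)) (by positivity)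
      _ = ((((L ^ m * L ^ k : ℕ) : ℝ)) ^ (d + 1))⁻¹ * (C₂ * (Af * (((k : ℕ) : ℝ) + 2) * ((L ^ m * L ^ k : ℕ) : ℝ) ^ (d + 1))) * (((L ^ m : ℕ) : ℝ) / ((L ^ m * L ^ k : ℕ) : ℝ))
          * (ω * Real.exp (-(δb * D)) * F) := by ring
      _ = C₂ * Af * ω * ((((k : ℕ) : ℝ) + 2) * ((L : ℝ) ^ k)⁻¹) * Real.exp (-(δb * D)) * F := by rw [hc]; ring
  -- ===== assembly =====
  have hk2 : (1 : ℝ) ≤ ((k : ℕ) : ℝ) + 2 := by have : (0:ℝ) ≤ k := Nat.cast_nonneg k; linarith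
  calc |_ + _| ≤ _ := abs_add_le _ _
    _ ≤ C₁ * An * Real.exp δb * ω * (((L : ℝ) ^ k)⁻¹) * Real.exp (-(δb * D)) * F
          + C₂ * Af * ω * ((((k : ℕ) : ℝ) + 2) * ((L : ℝ) ^ k)⁻¹) * Real.exp (-(δb * D)) * F := add_le_add hnear hfar
    _ ≤ C₁ * An * Real.exp δb * ω * ((((k : ℕ) : ℝ) + 2) * ((L : ℝ) ^ k)⁻¹) * Real.exp (-(δb * D)) * F
          + C₂ * Af * ω * ((((k : ℕ) : ℝ) + 2) * ((L : ℝ) ^ k)⁻¹) * Real.exp (-(δb * D)) * F := by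
        have hx : ((L : ℝ) ^ k)⁻¹ ≤ (((k : ℕ) : ℝ) + 2) * ((L : ℝ) ^ k)⁻¹ := le_mul_of_one_le_left (by positivity) hk2
        have hy : 0 ≤ C₁ * An * Real.exp δb * ω := by positivity
        have hz : 0 ≤ Real.exp (-(δb * D)) * F := by positivity
        have := mul_le_mul_of_nonneg_left hx hy
        nlinarith
    _ = (C₁ * An * Real.exp δb + C₂ * Af) * ω * ((((k : ℕ) : ℝ) + 2) / (L : ℝ) ^ k) * Real.exp (-(δb * tdistT M y y')) * F := by
        rw [hD, div_eq_mul_inv]; ring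


/-! ## §8 ★ dag-n15-a III-B's input `hDGc` on the King rung: the cell-oscillating part of a bounded multiplier behind the gradient -/

set_option maxHeartbeats 800000 in
/-- ★ **III-B's `hDGc` PRODUCED ON THE KING RUNG, UNIFORM IN `m`**: for odd `L ≥ 3` (`Odd L`, `2 ≤ L`), `d ≥ 1`, `a > 0`, `m₀² ≥ 0` there are `C, δ > 0` such that
for EVERY `k ≥ 1`, `m`, cube `2L^e`, mass `0 < m² ≤ m₀²`, direction `ν` and fine coefficient `c′` with `|c′| ≤ r`:
`HasMaj (coarse King blocks) (fine unit blocks) ((N′∇′_ν ⊗ 1)(A₀′⁻¹ ⊗ 1) ∘ 𝔇(M_{c′}, M_{blockAvg c′})) (C·r·((k+2)∕L^k)·e^{−δ|y−y′|_M})` — the sandwiched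
ZEROTH-ORDER coefficient defect of the GRADIENT entry of the first-order dressed pair (dag-n15-a III-B `hasMaj_idef_bgPair_of_sandwichRows`, hypothesis `hDGc`, at
`G′ := A₀′⁻¹ ⊗ 1`), NO letter on `∇c′`, NO fit of `c′`: `𝔇(M_{c′}, M_{blockAvg c′}) = M_{c′ − cellSweep c′}∘P` (M-C `idef_mulOp_eq` + `cellSweep_eq_pull_blockAvg`), the sweep's
`d + 1` pieces have zero line means (M-A `lineMean_sweepPiece`, size `2r`), and each is ★★.  This is M-C's ★★★ `hasMaj_comp_idef_mulOp_blockAvg_of_divAdj` at `T′ :=`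
King's gradient with the source-divergence-row hypothesis REPLACED by the kernel profiles — the drop-in for entry 1 of the dressed pair on the King rung.
[cite: Balaban1985BackgroundPropagators, (3.35) p.396, (3.52) p.400, (3.62)–(3.65) p.402 (mechanism); King1986, (2.13)–(2.17) p.653, Prop. 3.7 (3.63) p.663, p.664 (pairing)] -/
theorem hasMaj_kingDOp_comp_idef_mulOp_blockAvg (hd : 1 ≤ d) (hLodd : Odd L) (hL : 2 ≤ L) {a : ℝ} (ha : 0 < a) {m0sq : ℝ} (hm0 : 0 ≤ m0sq) :
    ∃ C δ : ℝ, 0 < C ∧ 0 < δ ∧ ∀ (k : ℕ), 1 ≤ k → ∀ (m e : ℕ) (M : Fin (d + 1) → ℕ) [∀ μ, NeZero (M μ)], (∀ μ, M μ = 2 * L ^ e) →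
      ∀ (msq : ℝ), 0 < msq → msq ≤ m0sq → ∀ (ν : Fin (d + 1)) (c' : Tor (fine (L ^ m * L ^ k) M) × Fin (d + 1) → ℝ) (r : ℝ), 0 ≤ r → (∀ z, |c' z| ≤ r) →
      HasMaj (BlockNorm.ofBlocks (unitTorusGeo L k M) (blkFine L k M))
        (BlockNorm.ofBlocks (unitTorusGeo L k M) (fun i : Tor (fine (L ^ m * L ^ k) M) × Fin (d + 1) => blockOf (L ^ m * L ^ k) M i.1))
        ((symbOp M (L ^ m * L ^ k) (sD M (L ^ m * L ^ k) ν ((L ^ m * L ^ k : ℕ) : ℝ)) ∘ₗ tensorId (Fin (d + 1)) (kingGOp L a msq (k + m) (L ^ m * L ^ k) M))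
          ∘ₗ idef (pull (kingPrV L k m M)) (pull (kingPrV L k m M)) (mulOp c') (mulOp (blockAvg (kingPrV L k m M) c')))
        (fun y y' => C * r * ((((k : ℕ) : ℝ) + 2) / (L : ℝ) ^ k) * Real.exp (-(δ * tdistT M y y'))) := by
  obtain ⟨C, δ, hC, hδ, H⟩ := hasMaj_kingGrad_comp_mulOp_pull_of_lineMean_zero L hd hLodd hL ha hm0
  refine ⟨2 * ((d : ℝ) + 1) * C, δ, by positivity, hδ, ?_⟩
  intro k hk m e M _ hM msq hmsq hcap ν c' r hr hc'
  have hℓ0 : 0 < L ^ m := pow_pos (Nat.pos_of_ne_zero (NeZero.ne L)) m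
  have hℓn : L ^ m ∣ L ^ m * L ^ k := Dvd.intro _ rfl
  -- the coefficient defect is the cell-oscillating part of `c′` behind King's prolongation (M-C)
  have hid : idef (pull (kingPrV L k m M)) (pull (kingPrV L k m M)) (mulOp c') (mulOp (blockAvg (kingPrV L k m M) c')) =
      mulOp (c' - cellSweep M (L ^ m * L ^ k) (L ^ m) (d + 1) c') ∘ₗ pull (kingPrV L k m M) := by
    rw [idef_mulOp_eq, cellSweep_eq_pull_blockAvg]
    rfl
  rw [hid]
  -- the sweep's telescoping pieces
  set pc : ℕ → (Tor (fine (L ^ m * L ^ k) M) × Fin (d + 1) → ℝ) :=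
    fun j => cellSweep M (L ^ m * L ^ k) (L ^ m) j c' - cellSweep M (L ^ m * L ^ k) (L ^ m) (j + 1) c' with hpc
  set T' := (symbOp M (L ^ m * L ^ k) (sD M (L ^ m * L ^ k) ν ((L ^ m * L ^ k : ℕ) : ℝ)) ∘ₗ tensorId (Fin (d + 1)) (kingGOp L a msq (k + m) (L ^ m * L ^ k) M)) with hT'
  have hsum : T' ∘ₗ (mulOp (c' - cellSweep M (L ^ m * L ^ k) (L ^ m) (d + 1) c') ∘ₗ pull (kingPrV L k m M)) =
      ∑ j ∈ range (d + 1), T' ∘ₗ (mulOp (pc j) ∘ₗ pull (kingPrV L k m M)) := by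
    refine LinearMap.ext fun φ => ?_
    rw [LinearMap.sum_apply, LinearMap.comp_apply]
    simp only [LinearMap.comp_apply]
    rw [← map_sum]
    congr 1
    funext z
    rw [Finset.sum_apply, mulOp_apply, pull_apply]
    simp only [mulOp_apply, pull_apply, ← Finset.sum_mul]
    rw [← Finset.sum_apply, sum_sweepPiece]
  rw [hsum]
  have hpiece : ∀ j, HasMaj (BlockNorm.ofBlocks (unitTorusGeo L k M) (blkFine L k M))
      (BlockNorm.ofBlocks (unitTorusGeo L k M) (fun i : Tor (fine (L ^ m * L ^ k) M) × Fin (d + 1) => blockOf (L ^ m * L ^ k) M i.1))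
      (T' ∘ₗ (mulOp (pc j) ∘ₗ pull (kingPrV L k m M)))
      (fun y y' => if j < d + 1 then C * (2 * r) * ((((k : ℕ) : ℝ) + 2) / (L : ℝ) ^ k) * Real.exp (-(δ * tdistT M y y')) else 0) := by
    intro j
    by_cases hj : j < d + 1
    · simp only [if_pos hj]
      exact H k hk m e M hM msq hmsq hcap ν ⟨j, hj⟩ (pc j) (2 * r) (by positivity)
        (lineMean_sweepPiece M _ hℓn hj c') (abs_sweepPiece_le M _ hℓ0 hc' j)
    · simp only [if_neg hj]
      have hz : pc j = 0 := by
        simp only [hpc]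
        rw [cellSweep_succ_of_le M _ (not_lt.mp hj), sub_self]
      have h0 : T' ∘ₗ (mulOp (pc j) ∘ₗ pull (kingPrV L k m M)) = 0 := by
        refine LinearMap.ext fun φ => ?_
        have hm : (mulOp (pc j) ∘ₗ pull (kingPrV L k m M)) φ = 0 := funext fun z => by
          rw [LinearMap.comp_apply, mulOp_apply, hz]; simp
        rw [LinearMap.comp_apply, hm, map_zero, LinearMap.zero_apply]
      rw [h0]
      exact B11SectG.hasMaj_zero _ _
  refine (hasMaj_sum _ _ hpiece (d + 1)).mono fun y y' => le_of_eq ?_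
  rw [Finset.sum_congr rfl fun j hj => if_pos (mem_range.mp hj), sum_const, card_range, nsmul_eq_mul]
  push_cast
  ring

end Summit.QuantumFields.YangMills.BalabanUVNodes.N15.KingModel.CellOsc
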